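import Summits.QuantumFields.YangMills.Theorems.FlatTubeReductionKernelParityFloor
import HarnessLib

/-!
# Kernel parity with a REGIONAL relative error and an ABSOLUTE tail; the floor by parity on the SUPPORT of the trial state
# (route `FlatTubeReduction`, crux K1 `NearFlatRatioLaw` stmt-QuantumFields-24720, registered stub `stub_boRate` = FCL 23943's `BORateAll`; line «borate»;
# rung R2b1 = RECORD-label femto gap; no summit statement is proved here)

Seat `ym-line-ftr-p1` g7 (prover).  The c-frozen Gaussian model is relatively close to the true kernel only on the stiff CORE `|w| ≲ β^{-1/2}·polylog`; off the core both
kernels are super-polynomially small (route RED lane A's currency: `…InnerKernelComparisonTail`, hypothesis `|K₂ − sK₁| ≤ ηsK₁ + τ`, the disprover's rigidity theorems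
`Negative/ModelPerturbedNearRigidity`).  The parity lemmas `abs_form_sub_le_of_kernel_near_odd` (p632175) / `form_ge_of_exp_near_odd` (p638804) assumed the relative
structure EVERYWHERE; here are the versions the chart seat can actually instantiate:
* ★★ `abs_form_sub_le_of_kernel_near_odd_add` — `|K₂ − K₁(1 + A)| ≤ η·K₁ + τ` pointwise (relative on the core, absolute `τ` off it), `K₁ ≥ 0` symmetric `ι`-even with rows
  `≤ M₁`, `A` `ι`-odd, `f` `ι`-even ⇒ `|⟨f,K₂f⟩ − ⟨f,K₁f⟩| ≤ η·M₁·‖f‖₂² + τ·‖f‖₁²` (s-finite measure; the tail is paid by the `L¹` norm, i.e. by the measure of the support —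
  same currency as lane A's `abs_form_sub_le_of_kernel_near_add_L1`).  Direct proof: the odd term integrates to zero, the rest is Schur + Fubini;
* ★ `form_ge_of_exp_near_odd_on` — the FLOOR by parity with the exponent structure `K₂ = K₁·exp(A + R)`, `|R| ≤ ρ` assumed only on `S × S` where `S ⊇ supp f` (the `k = 0` trial
  state lives on the core): `∫∫fK₁f − ρM₁‖f‖² ≤ ∫∫fK₂f` for `f ≥ 0` even supported in `S`.
HONEST FRAMING: elementary measure theory for the registered stub of a crux of the CONDITIONAL reduction route to the femto rung R2b1 (RECORD label); the chart supplying
`K₁, K₂, A, R, ι, S` is OPEN (route RED lane A C4-CORE (f) + the rate twin); nothing here is infinite volume, a continuum limit or the Clay mass gap.  No definitions, no `sorry`.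

## References
* B. Helffer, *Spectral Theory and its Applications*, CUP 2013, Lemma 7.1 (Schur's test) — [cite: Helffer2013, Lemma 7.1 pp.77–78].
* M. Lüscher, Nucl. Phys. B219 (1983) 233, §3 (parity of the cubic vertex) — [cite: Luscher1983, §3].
-/

set_option autoImplicit false

noncomputable section

open MeasureTheory

namespace Summit.QuantumFields.YangMills.Theorems.FemtoTransferGap.KernelParity

open Literature.Analysis.OperatorTheory

variable {X : Type*} [MeasurableSpace X] {μ : Measure X} [SFinite μ]

/-- ★★ **DIAGONAL comparison with an odd first-order term, regional relative error plus absolute tail.**  `K₁ ≥ 0` symmetric, `ι`-even, rows `≤ M₁`; `A` `ι`-odd;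
`|K₂ − K₁(1 + A)| ≤ η·K₁ + τ` pointwise (`η ≥ 0`); `f` `ι`-even with `f`, `f²` integrable (and the product-integrability side conditions).  Then
`|⟨f,K₂f⟩ − ⟨f,K₁f⟩| ≤ η·M₁·∫f² + τ·(∫|f|)²`. [cite: Helffer2013, Lemma 7.1 pp.77–78] [cite: Luscher1983, §3] -/
theorem abs_form_sub_le_of_kernel_near_odd_add (ι : X ≃ᵐ X) (hι : MeasurePreserving ι μ μ)
    {K₁ K₂ A : X → X → ℝ} {η τ M₁ : ℝ} (hη : 0 ≤ η) (hK₁ : ∀ x y, 0 ≤ K₁ x y)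
    (hsymm : ∀ x y, K₁ x y = K₁ y x) (hrow : ∀ᵐ x ∂μ, ∫ y, K₁ x y ∂μ ≤ M₁)
    (hK₁ι : ∀ x y, K₁ (ι x) (ι y) = K₁ x y) (hAι : ∀ x y, A (ι x) (ι y) = -A x y)
    (hnear : ∀ x y, |K₂ x y - K₁ x y * (1 + A x y)| ≤ η * K₁ x y + τ)
    {f : X → ℝ} (hfι : ∀ x, f (ι x) = f x) (hf : Integrable (fun x => f x ^ 2) μ) (hf1 : Integrable f μ)
    (hI2 : Integrable (fun p : X × X => f p.1 * K₂ p.1 p.2 * f p.2) (μ.prod μ))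
    (hIA : Integrable (fun p : X × X => f p.1 * (K₁ p.1 p.2 * A p.1 p.2) * f p.2) (μ.prod μ))
    (hI : Integrable (fun p : X × X => |f p.1| * K₁ p.1 p.2 * |f p.2|) (μ.prod μ))
    (hIs : Integrable (fun p : X × X => f p.1 * K₁ p.1 p.2 * f p.2) (μ.prod μ))
    (hI₁ : Integrable (fun p : X × X => K₁ p.1 p.2 * f p.1 ^ 2) (μ.prod μ))
    (hI₂ : Integrable (fun p : X × X => K₁ p.1 p.2 * f p.2 ^ 2) (μ.prod μ)) :
    |(∫ x, ∫ y, f x * K₂ x y * f y ∂μ ∂μ) - ∫ x, ∫ y, f x * K₁ x y * f y ∂μ ∂μ|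
      ≤ η * M₁ * (∫ x, f x ^ 2 ∂μ) + τ * (∫ x, |f x| ∂μ) ^ 2 := by
  -- the odd term integrates to zero
  have hodd : ∫ p, f p.1 * (K₁ p.1 p.2 * A p.1 p.2) * f p.2 ∂(μ.prod μ) = 0 :=
    integral_prod_eq_zero_of_odd ι hι (F := fun p : X × X => f p.1 * (K₁ p.1 p.2 * A p.1 p.2) * f p.2) fun x y => by
      dsimp only
      rw [hfι, hfι, hK₁ι, hAι]
      ring
  -- pass to the product measure: the difference is the integral of `f·(K₂ − K₁(1+A))·f`
  have hff : Integrable (fun p : X × X => |f p.1| * |f p.2|) (μ.prod μ) := hf1.abs.mul_prod hf1.abs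
  have hE : Integrable (fun p : X × X => f p.1 * (K₂ p.1 p.2 - K₁ p.1 p.2 * (1 + A p.1 p.2)) * f p.2) (μ.prod μ) := by
    have e : (fun p : X × X => f p.1 * (K₂ p.1 p.2 - K₁ p.1 p.2 * (1 + A p.1 p.2)) * f p.2)
        = fun p => (f p.1 * K₂ p.1 p.2 * f p.2 - f p.1 * K₁ p.1 p.2 * f p.2) - f p.1 * (K₁ p.1 p.2 * A p.1 p.2) * f p.2 := by
      funext p; ring
    rw [e]
    have i1 : Integrable (fun p : X × X => f p.1 * K₂ p.1 p.2 * f p.2 - f p.1 * K₁ p.1 p.2 * f p.2) (μ.prod μ) := hI2.sub hIs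
    exact i1.sub hIA
  have hdiff : (∫ x, ∫ y, f x * K₂ x y * f y ∂μ ∂μ) - ∫ x, ∫ y, f x * K₁ x y * f y ∂μ ∂μ
      = ∫ p, f p.1 * (K₂ p.1 p.2 - K₁ p.1 p.2 * (1 + A p.1 p.2)) * f p.2 ∂(μ.prod μ) := by
    rw [← integral_prod _ hI2, ← integral_prod _ hIs, ← integral_sub hI2 hIs]
    have i1 : Integrable (fun p : X × X => f p.1 * K₂ p.1 p.2 * f p.2 - f p.1 * K₁ p.1 p.2 * f p.2) (μ.prod μ) := hI2.sub hIs
    have e : ∫ p, f p.1 * (K₂ p.1 p.2 - K₁ p.1 p.2 * (1 + A p.1 p.2)) * f p.2 ∂(μ.prod μ)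
        = ∫ p, ((f p.1 * K₂ p.1 p.2 * f p.2 - f p.1 * K₁ p.1 p.2 * f p.2) - f p.1 * (K₁ p.1 p.2 * A p.1 p.2) * f p.2) ∂(μ.prod μ) :=
      integral_congr_ae (ae_of_all _ fun p => by ring)
    rw [e, integral_sub i1 hIA, hodd, sub_zero]
  rw [hdiff]
  -- pointwise bound by the majorant `η|f|K₁|f| + τ|f||f|`
  have hmaj : Integrable (fun p : X × X => η * (|f p.1| * K₁ p.1 p.2 * |f p.2|) + τ * (|f p.1| * |f p.2|)) (μ.prod μ) :=
    (hI.const_mul η).add (hff.const_mul τ)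
  have hpt : ∀ p : X × X, ‖f p.1 * (K₂ p.1 p.2 - K₁ p.1 p.2 * (1 + A p.1 p.2)) * f p.2‖
      ≤ η * (|f p.1| * K₁ p.1 p.2 * |f p.2|) + τ * (|f p.1| * |f p.2|) := by
    intro p
    rw [Real.norm_eq_abs, abs_mul, abs_mul]
    have h := hnear p.1 p.2
    have h0 : 0 ≤ |f p.1| := abs_nonneg _
    have h0' : 0 ≤ |f p.2| := abs_nonneg _
    calc |f p.1| * |K₂ p.1 p.2 - K₁ p.1 p.2 * (1 + A p.1 p.2)| * |f p.2| ≤ |f p.1| * (η * K₁ p.1 p.2 + τ) * |f p.2| := by gcongr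
      _ = η * (|f p.1| * K₁ p.1 p.2 * |f p.2|) + τ * (|f p.1| * |f p.2|) := by ring
  refine (Real.norm_eq_abs _ ▸ norm_integral_le_of_norm_le hmaj (ae_of_all _ hpt)).trans ?_
  have i1 : Integrable (fun p : X × X => η * (|f p.1| * K₁ p.1 p.2 * |f p.2|)) (μ.prod μ) := hI.const_mul η
  have i2 : Integrable (fun p : X × X => τ * (|f p.1| * |f p.2|)) (μ.prod μ) := hff.const_mul τ
  rw [integral_add i1 i2, integral_const_mul, integral_const_mul]
  -- Schur for the relative part, Fubini for the tail
  have habs2 : Integrable (fun x => |f x| ^ 2) μ := hf.congr (ae_of_all _ fun x => (sq_abs (f x)).symm)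
  have hSchur := SchurTest.integral_integral_mul_kernel_mul_self_le_of_symm (μ := μ) K₁ (fun x => |f x|) hK₁ hsymm hrow habs2 hI
    (hI₁.congr (ae_of_all _ fun p => by simp only [sq_abs])) (hI₂.congr (ae_of_all _ fun p => by simp only [sq_abs]))
  simp only [sq_abs] at hSchur
  rw [integral_prod _ hI] 
  have htail : ∫ p, |f p.1| * |f p.2| ∂(μ.prod μ) = (∫ x, |f x| ∂μ) ^ 2 := by
    rw [integral_prod_mul (fun x => |f x|) (fun y => |f y|), sq]
  rw [htail]
  have := mul_le_mul_of_nonneg_left hSchur hη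
  nlinarith [mul_le_mul_of_nonneg_left hSchur hη, sq_nonneg (∫ x, |f x| ∂μ)]

/-- ★ **FLOOR by parity, hypotheses on the support only.**  As `form_ge_of_exp_near_odd` (p638804), but the exponent structure `K₂ = K₁·exp(A + R)` and the bound `|R| ≤ ρ`
are assumed only for `x, y ∈ S`, where the even nonnegative trial state `f` vanishes off `S` (the `k = 0` trial state of the floor lives on the stiff core, where the
c-frozen Gaussian model is relatively accurate).  Conclusion: `∫∫fK₁f − ρ·M₁·∫f² ≤ ∫∫fK₂f`. [cite: Helffer2013, Lemma 7.1 pp.77–78] [cite: Luscher1983, §3] -/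
theorem form_ge_of_exp_near_odd_on (ι : X ≃ᵐ X) (hι : MeasurePreserving ι μ μ) (S : Set X)
    {K₁ K₂ A R : X → X → ℝ} {ρ M₁ : ℝ} (hρ : 0 ≤ ρ) (hK₁ : ∀ x y, 0 ≤ K₁ x y)
    (hsymm : ∀ x y, K₁ x y = K₁ y x) (hrow : ∀ᵐ x ∂μ, ∫ y, K₁ x y ∂μ ≤ M₁)
    (hK₁ι : ∀ x y, K₁ (ι x) (ι y) = K₁ x y) (hAι : ∀ x y, A (ι x) (ι y) = -A x y)
    (hK₂S : ∀ x y, x ∈ S → y ∈ S → K₂ x y = K₁ x y * Real.exp (A x y + R x y)) (hRS : ∀ x y, x ∈ S → y ∈ S → |R x y| ≤ ρ)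
    {f : X → ℝ} (hfι : ∀ x, f (ι x) = f x) (hf0 : ∀ x, 0 ≤ f x) (hfS : ∀ x, x ∉ S → f x = 0) (hf : Integrable (fun x => f x ^ 2) μ)
    (hI2 : Integrable (fun p : X × X => f p.1 * K₂ p.1 p.2 * f p.2) (μ.prod μ))
    (hIA : Integrable (fun p : X × X => f p.1 * (K₁ p.1 p.2 * A p.1 p.2) * f p.2) (μ.prod μ))
    (hIs : Integrable (fun p : X × X => f p.1 * K₁ p.1 p.2 * f p.2) (μ.prod μ))
    (hI₁ : Integrable (fun p : X × X => K₁ p.1 p.2 * f p.1 ^ 2) (μ.prod μ))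
    (hI₂ : Integrable (fun p : X × X => K₁ p.1 p.2 * f p.2 ^ 2) (μ.prod μ)) :
    (∫ x, ∫ y, f x * K₁ x y * f y ∂μ ∂μ) - ρ * M₁ * ∫ x, f x ^ 2 ∂μ ≤ ∫ x, ∫ y, f x * K₂ x y * f y ∂μ ∂μ := by
  have hSchur : ∫ x, ∫ y, f x * K₁ x y * f y ∂μ ∂μ ≤ M₁ * ∫ x, f x ^ 2 ∂μ :=
    SchurTest.integral_integral_mul_kernel_mul_self_le_of_symm (μ := μ) K₁ f hK₁ hsymm hrow hf hIs hI₁ hI₂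
  have hodd : ∫ p, f p.1 * (K₁ p.1 p.2 * A p.1 p.2) * f p.2 ∂(μ.prod μ) = 0 :=
    integral_prod_eq_zero_of_odd ι hι (F := fun p : X × X => f p.1 * (K₁ p.1 p.2 * A p.1 p.2) * f p.2) fun x y => by
      dsimp only
      rw [hfι, hfι, hK₁ι, hAι]
      ring
  -- pointwise lower bound (trivial off `S × S`, where `f ⊗ f` vanishes)
  have hpt : ∀ p : X × X, (f p.1 * K₁ p.1 p.2 * f p.2 + f p.1 * (K₁ p.1 p.2 * A p.1 p.2) * f p.2) - ρ * (f p.1 * K₁ p.1 p.2 * f p.2)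
      ≤ f p.1 * K₂ p.1 p.2 * f p.2 := by
    intro p
    by_cases hx : p.1 ∈ S
    · by_cases hy : p.2 ∈ S
      · have h1 : 1 + (A p.1 p.2 + R p.1 p.2) ≤ Real.exp (A p.1 p.2 + R p.1 p.2) := by
          have := Real.add_one_le_exp (A p.1 p.2 + R p.1 p.2); linarith
        have h2 : -ρ ≤ R p.1 p.2 := (abs_le.mp (hRS p.1 p.2 hx hy)).1
        have hφK : 0 ≤ f p.1 * f p.2 * K₁ p.1 p.2 := mul_nonneg (mul_nonneg (hf0 _) (hf0 _)) (hK₁ _ _)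
        rw [hK₂S p.1 p.2 hx hy]
        have h3 : f p.1 * f p.2 * K₁ p.1 p.2 * (1 + (A p.1 p.2 + R p.1 p.2)) ≤ f p.1 * f p.2 * K₁ p.1 p.2 * Real.exp (A p.1 p.2 + R p.1 p.2) :=
          mul_le_mul_of_nonneg_left h1 hφK
        have h4 : f p.1 * f p.2 * K₁ p.1 p.2 * (1 + (A p.1 p.2 + -ρ)) ≤ f p.1 * f p.2 * K₁ p.1 p.2 * (1 + (A p.1 p.2 + R p.1 p.2)) := by
          refine mul_le_mul_of_nonneg_left ?_ hφK; linarith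
        nlinarith
      · rw [hfS p.2 hy]; simp
    · rw [hfS p.1 hx]; simp
  have hadd : Integrable (fun p : X × X => f p.1 * K₁ p.1 p.2 * f p.2 + f p.1 * (K₁ p.1 p.2 * A p.1 p.2) * f p.2) (μ.prod μ) := hIs.add hIA
  have hsm : Integrable (fun p : X × X => ρ * (f p.1 * K₁ p.1 p.2 * f p.2)) (μ.prod μ) := hIs.const_mul ρ
  have hL : Integrable (fun p : X × X => (f p.1 * K₁ p.1 p.2 * f p.2 + f p.1 * (K₁ p.1 p.2 * A p.1 p.2) * f p.2)
      - ρ * (f p.1 * K₁ p.1 p.2 * f p.2)) (μ.prod μ) := hadd.sub hsm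
  have hint := integral_mono hL hI2 hpt
  rw [integral_sub hadd hsm, integral_add hIs hIA, hodd, add_zero, integral_const_mul] at hint
  rw [← integral_prod _ hI2, ← integral_prod _ hIs]
  have hpos : ρ * ∫ p, f p.1 * K₁ p.1 p.2 * f p.2 ∂(μ.prod μ) ≤ ρ * M₁ * ∫ x, f x ^ 2 ∂μ := by
    rw [integral_prod _ hIs, mul_assoc]
    exact mul_le_mul_of_nonneg_left hSchur hρ
  linarith

end Summit.QuantumFields.YangMills.Theorems.FemtoTransferGap.KernelParity

end
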